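import Literature.AlgebraicGeometry.Pohlmann1968.HodgeClassesProductSpanCMProductsRank
import Literature.NumberTheory.ComplexMultiplication.CMTypeRankTwoBlocksPartialConj
import Literature.NumberTheory.ComplexMultiplication.PartialConjugationOfRealIntersection
import HarnessLib

/-!
# Hodge classes on `X × Y` for CM products whose Galois closures MEET IN A TOTALLY REAL FIELD are products of Hodge
# classes of the factors — for ARBITRARY (possibly degenerate) CM types; hence `HC(X) ∧ HC(Y) ⟹ HC(X × Y)`

Family `hodge`, layer `Literature/AlgebraicGeometry/Pohlmann1968`; cell `pub-hodgecm2` (COR-CM), count-neutral own-lane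
sequel of `Pohlmann1968/HodgeClassesProductSpanCMProductsRank` (rank additivity `rank(Σ ⊔ Σ') + 1 = rank Σ + rank Σ'`
⟹ `HodgeClassesProductSpan (⨁ A) (⨁ A')`) and `…CMProductsDisjoint` (Galois closures meeting in `ℚ`).  HONEST FRAMING:
unconditional structure theorem on Hodge classes of CM abelian varieties; not a step of the summit chain.

THE CRITERION.  For realisations `(A_i, ι_i, θ_i)` of CM types `Φ_i` of CM fields `K_i` (`i < n`) and `(A'_j, …)` of
`Φ'_j` of `K'_j` (`j < m`), let `L = ∏_i K_i^{gal}`, `L' = ∏_j K'_j^{gal} ≤ ℂ` be the composita of the Galois closures.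
If complex conjugation fixes `L ∩ L'` pointwise — i.e. the (Galois) field `L ∩ L'` is TOTALLY REAL, e.g. of odd degree,
or `= ℚ` — then `Aut(ℂ)` contains a PARTIAL CONJUGATION (conjugation on every `Hom(K_i, ℂ)`, identity on every
`Hom(K'_j, ℂ)`; the gluing lemma `exists_ringEquiv_apply_eq_of_normal` of `…/PartialConjugationOfRealIntersection`), the
two-block rank is additive (`typeRank_sum_add_one_eq_of_partialConj`, i.e. `Hg(X × Y) = Hg(X) × Hg(Y)`), and therefore

* `hodgeClassesProductSpan_biproduct_of_conj_apply_eq` — `HodgeClassesProductSpan (⨁ A) (⨁ A')`;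
* `hodgeConjectureFor_prod_of_isIsogenous_biproduct_of_conj_apply_eq` — **for `X ~ ⨁ A_i`, `Y ~ ⨁ A'_j`:
  `HC(X) ∧ HC(Y) ⟹ HC(X × Y)`**; `…_of_odd_finrank_inf` — the odd-degree case.

What is NEW.  The types `Φ_i`, `Φ'_j` are ARBITRARY: the tree's `Summits/…/RealIntersectionCMFieldsHodge` (seat b23) draws
`HC(∏ A_i^{k_i})` from the same partial conjugations for NONDEGENERATE types only (`B• = D•`), and
`…CMProductsDisjoint` needs `L ∩ L' = ℚ`.  Here HC of the factors may come from anywhere (e.g. a degenerate Weil-type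
fourfold where it is Markman's theorem) and the fields may share any totally real subfield — two cyclic quartic CM fields
over the same `ℚ(√d)`, `ℚ(ζ₇)` and `ℚ(ζ₇)⁺(√−3)`, `F·k` and `F·k'` for a totally real Galois `F`.  Theorems only; no
definition, no named fact; axioms `propext`, `Classical.choice`, `Quot.sound`.

## References
* [MoonenZarhin1999LowDim] B. Moonen, Yu. Zarhin, Math. Ann. 315 (1999) 711–733, §3 (3.1).
* [Gordon1999HodgeAVSurvey] B. B. Gordon, *A survey of the Hodge conjecture for abelian varieties*, §3 Theorem (Imai,
  Murty) with proof; 7.5–7.7.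
* [Lang2002] S. Lang, *Algebra*, GTM 211, VI §1 Thm. 1.14, V §2 Thm. 2.8.
-/

noncomputable section

open CategoryTheory CategoryTheory.Limits NumberField

namespace Literature.AlgebraicGeometry.Pohlmann1968

open Module
open Literature.AlgebraicGeometry.Motives (AbelianVariety CMType)
open Literature.AlgebraicGeometry.HodgeTheory
open Literature.AlgebraicGeometry.ComplexMultiplication (IsCMTypeRealisation)
open Literature.NumberTheory.ComplexMultiplication

/-! ### §1 Partial conjugations and totally real intersections give rank additivity -/

section Rank

variable {n m : ℕ} {K : Fin n → Type} {K' : Fin m → Type}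
  [∀ i, Field (K i)] [∀ i, NumberField (K i)] [∀ j, Field (K' j)] [∀ j, NumberField (K' j)]
  [∀ i, IsCMField (K i)] [∀ j, IsCMField (K' j)]

/-- **A partial conjugation on the embeddings gives rank additivity**: if some `σ ∈ Aut(ℂ)` is complex conjugation on
every `Hom(K_i, ℂ)` and the identity on every `Hom(K'_j, ℂ)`, then `rank(Σ ⊔ Σ') + 1 = cmFamilyRank Φ + cmFamilyRank Φ'`
(`Hg(X × Y) = Hg(X) × Hg(Y)`) for ALL CM types `Φ_i`, `Φ'_j`. [cite: Gordon1999HodgeAVSurvey, §3 Theorem (Imai, Murty), proof] -/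
theorem typeRank_sum_add_one_eq_of_partialConj_emb [NeZero n] [NeZero m] (Φ : ∀ i, CMType (K i))
    (Φ' : ∀ j, CMType (K' j))
    (hσ : ∃ σ : ℂ ≃+* ℂ, (∀ (i : Fin n) (s : K i →+* ℂ), σ • s = (starRingAut : ℂ ≃+* ℂ) • s) ∧
      ∀ (j : Fin m) (t : K' j →+* ℂ), σ • t = t) :
    typeRank (ℂ ≃+* ℂ) {z : (Σ i, (K i →+* ℂ)) ⊕ (Σ j, (K' j →+* ℂ)) |
        Sum.elim (· ∈ CMAlgebra.familyType Φ) (· ∈ CMAlgebra.familyType Φ') z} + 1 =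
      CMAlgebra.cmFamilyRank Φ + CMAlgebra.cmFamilyRank Φ' := by
  haveI : Nonempty (Σ i, (K i →+* ℂ)) := by
    obtain ⟨s⟩ := (inferInstance : Nonempty (K 0 →+* ℂ))
    exact ⟨⟨0, s⟩⟩
  haveI : Nonempty (Σ j, (K' j →+* ℂ)) := by
    obtain ⟨t⟩ := (inferInstance : Nonempty (K' 0 →+* ℂ))
    exact ⟨⟨0, t⟩⟩
  obtain ⟨σ, h1, h2⟩ := hσ
  refine typeRank_sum_add_one_eq_of_partialConj (CMAlgebra.isCMTypeWith_familyType Φ)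
    (CMAlgebra.isCMTypeWith_familyType Φ') ⟨σ, fun x => ?_, fun y => ?_⟩
  · obtain ⟨i, s⟩ := x
    rw [CMAlgebra.smul_sigma_mk, CMAlgebra.smul_sigma_mk, h1 i s]
  · obtain ⟨j, t⟩ := y
    rw [CMAlgebra.smul_sigma_mk, h2 j t]

/-- **Galois closures meeting in a totally real field give rank additivity.**  If complex conjugation fixes pointwise
`(∏_i K_i^{gal}) ∩ (∏_j K'_j^{gal})` (composita of the Galois closures in `ℂ`), a partial conjugation exists (the gluing
lemma `exists_ringEquiv_apply_eq_of_normal`: in `Gal(L L'/ℚ)` the pair `(ρ|_L, id_{L'})` agrees on `L ∩ L'`), hence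
`rank(Σ ⊔ Σ') + 1 = cmFamilyRank Φ + cmFamilyRank Φ'`. [cite: Lang2002, VI §1 Thm. 1.14 and V §2 Thm. 2.8]
[cite: Gordon1999HodgeAVSurvey, §3 Theorem (Imai, Murty), proof] -/
theorem typeRank_sum_add_one_eq_of_conj_apply_eq [NeZero n] [NeZero m] (Φ : ∀ i, CMType (K i))
    (Φ' : ∀ j, CMType (K' j))
    (hreal : ∀ x : ℂ, x ∈ (⨆ i, IntermediateField.normalClosure ℚ (K i) ℂ) →
      x ∈ (⨆ j, IntermediateField.normalClosure ℚ (K' j) ℂ) → starRingEnd ℂ x = x) :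
    typeRank (ℂ ≃+* ℂ) {z : (Σ i, (K i →+* ℂ)) ⊕ (Σ j, (K' j →+* ℂ)) |
        Sum.elim (· ∈ CMAlgebra.familyType Φ) (· ∈ CMAlgebra.familyType Φ') z} + 1 =
      CMAlgebra.cmFamilyRank Φ + CMAlgebra.cmFamilyRank Φ' := by
  haveI : ∀ i : Fin n, @Normal ℚ ↥(IntermediateField.normalClosure ℚ (K i) ℂ) _ _ (IntermediateField.algebra' _) :=
    normal_normalClosure_complex
  haveI : ∀ j : Fin m, @Normal ℚ ↥(IntermediateField.normalClosure ℚ (K' j) ℂ) _ _ (IntermediateField.algebra' _) :=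
    normal_normalClosure_complex
  obtain ⟨τ, hA, hB⟩ := exists_ringEquiv_apply_eq_of_normal
    (A := ⨆ i, IntermediateField.normalClosure ℚ (K i) ℂ) (B := ⨆ j, IntermediateField.normalClosure ℚ (K' j) ℂ)
    (starRingAut : ℂ ≃+* ℂ) (fun x h₁ h₂ => by rw [starRingAut_apply, ← starRingEnd_apply]; exact hreal x h₁ h₂)
  refine typeRank_sum_add_one_eq_of_partialConj_emb Φ Φ' ⟨τ, fun i s => RingHom.ext fun x => ?_,
    fun j t => RingHom.ext fun x => hB _ ?_⟩
  · rw [ringEquiv_smul_apply, ringEquiv_smul_apply]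
    exact hA _ ((le_iSup (fun i => IntermediateField.normalClosure ℚ (K i) ℂ) i :
      IntermediateField.normalClosure ℚ (K i) ℂ ≤ _) (apply_mem_normalClosure i s x))
  · exact (le_iSup (fun j => IntermediateField.normalClosure ℚ (K' j) ℂ) j :
      IntermediateField.normalClosure ℚ (K' j) ℂ ≤ _) (apply_mem_normalClosure j t x)

/-- A subfield of a finite extension inside `ℂ` is finite. [folklore] -/
private theorem finiteDimensional_of_le'' {E E' : IntermediateField ℚ ℂ} [FiniteDimensional ℚ E] (h : E' ≤ E) :
    FiniteDimensional ℚ E' :=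
  FiniteDimensional.of_injective (IntermediateField.inclusion h).toLinearMap (IntermediateField.inclusion_injective h)

/-- **Odd-degree criterion**: if `(∏_i K_i^{gal}) ∩ (∏_j K'_j^{gal})` has ODD degree over `ℚ`, it is totally real (a
Galois subfield of `ℂ` of odd degree is fixed by conjugation, `conj_apply_eq_of_odd_finrank`), so the two-block rank is
additive. [cite: Gordon1999HodgeAVSurvey, §3 Theorem (Imai, Murty), proof] -/
theorem typeRank_sum_add_one_eq_of_odd_finrank_inf [NeZero n] [NeZero m] (Φ : ∀ i, CMType (K i))
    (Φ' : ∀ j, CMType (K' j))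
    (hodd : Odd (Module.finrank ℚ ↥((⨆ i, IntermediateField.normalClosure ℚ (K i) ℂ) ⊓
      (⨆ j, IntermediateField.normalClosure ℚ (K' j) ℂ)))) :
    typeRank (ℂ ≃+* ℂ) {z : (Σ i, (K i →+* ℂ)) ⊕ (Σ j, (K' j →+* ℂ)) |
        Sum.elim (· ∈ CMAlgebra.familyType Φ) (· ∈ CMAlgebra.familyType Φ') z} + 1 =
      CMAlgebra.cmFamilyRank Φ + CMAlgebra.cmFamilyRank Φ' := by
  haveI : ∀ i : Fin n, @Normal ℚ ↥(IntermediateField.normalClosure ℚ (K i) ℂ) _ _ (IntermediateField.algebra' _) :=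
    normal_normalClosure_complex
  haveI : ∀ j : Fin m, @Normal ℚ ↥(IntermediateField.normalClosure ℚ (K' j) ℂ) _ _ (IntermediateField.algebra' _) :=
    normal_normalClosure_complex
  refine typeRank_sum_add_one_eq_of_conj_apply_eq Φ Φ' fun x h₁ h₂ => ?_
  letI : Algebra ℚ ↥((⨆ i, IntermediateField.normalClosure ℚ (K i) ℂ) ⊓
      (⨆ j, IntermediateField.normalClosure ℚ (K' j) ℂ)) := IntermediateField.algebra' _
  haveI : FiniteDimensional ℚ ↥((⨆ i, IntermediateField.normalClosure ℚ (K i) ℂ) ⊓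
      (⨆ j, IntermediateField.normalClosure ℚ (K' j) ℂ)) := finiteDimensional_of_le'' inf_le_left
  exact conj_apply_eq_of_odd_finrank _ hodd ⟨h₁, h₂⟩

end Rank

/-! ### §2 Product span and the Hodge conjecture for products -/

section Main

variable {n m : ℕ} {K : Fin n → Type} {K' : Fin m → Type}
  [∀ i, Field (K i)] [∀ i, NumberField (K i)] [∀ j, Field (K' j)] [∀ j, NumberField (K' j)]
  [∀ i, IsCMField (K i)] [∀ j, IsCMField (K' j)]
  {Φ : ∀ i, CMType (K i)} {Φ' : ∀ j, CMType (K' j)}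
  {A : Fin n → AbelianVariety ℂ} {A' : Fin m → AbelianVariety ℂ}
  {ι : ∀ i, 𝓞 (K i) →+* End (A i)} {ι' : ∀ j, 𝓞 (K' j) →+* End (A' j)}
  {θ : ∀ i, K i →+* Module.End ℂ (complexBetti (A i).X 1)}
  {θ' : ∀ j, K' j →+* Module.End ℂ (complexBetti (A' j).X 1)}

/-- **Product span from a partial conjugation**: if some `σ ∈ Aut(ℂ)` is conjugation on every `Hom(K_i, ℂ)` and the
identity on every `Hom(K'_j, ℂ)`, then `HodgeClassesProductSpan (⨁ A) (⨁ A')` for realisations of ARBITRARY CM types.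
[cite: MoonenZarhin1999LowDim, §3 (3.1)] [cite: Gordon1999HodgeAVSurvey, §3 Theorem (Imai, Murty), proof] -/
theorem hodgeClassesProductSpan_biproduct_of_partialConj [NeZero n] [NeZero m]
    (hA : ∀ i, IsCMTypeRealisation (Φ i) (A i) (ι i) (θ i))
    (hA' : ∀ j, IsCMTypeRealisation (Φ' j) (A' j) (ι' j) (θ' j))
    (hσ : ∃ σ : ℂ ≃+* ℂ, (∀ (i : Fin n) (s : K i →+* ℂ), σ • s = (starRingAut : ℂ ≃+* ℂ) • s) ∧
      ∀ (j : Fin m) (t : K' j →+* ℂ), σ • t = t) :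
    HodgeClassesProductSpan (⨁ A) (⨁ A') :=
  hodgeClassesProductSpan_biproduct_of_typeRank_add hA hA' (typeRank_sum_add_one_eq_of_partialConj_emb Φ Φ' hσ)

/-- **Product span when the Galois closures meet in a totally real field**: complex conjugation fixing
`(∏ K_i^{gal}) ∩ (∏ K'_j^{gal})` pointwise ⟹ `HodgeClassesProductSpan (⨁ A) (⨁ A')`, arbitrary CM types.
[cite: MoonenZarhin1999LowDim, §3 (3.1)] [cite: Lang2002, VI §1 Thm. 1.14] -/
theorem hodgeClassesProductSpan_biproduct_of_conj_apply_eq [NeZero n] [NeZero m]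
    (hA : ∀ i, IsCMTypeRealisation (Φ i) (A i) (ι i) (θ i))
    (hA' : ∀ j, IsCMTypeRealisation (Φ' j) (A' j) (ι' j) (θ' j))
    (hreal : ∀ x : ℂ, x ∈ (⨆ i, IntermediateField.normalClosure ℚ (K i) ℂ) →
      x ∈ (⨆ j, IntermediateField.normalClosure ℚ (K' j) ℂ) → starRingEnd ℂ x = x) :
    HodgeClassesProductSpan (⨁ A) (⨁ A') :=
  hodgeClassesProductSpan_biproduct_of_typeRank_add hA hA' (typeRank_sum_add_one_eq_of_conj_apply_eq Φ Φ' hreal)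

/-- **Isogenous factors**: `X ~ ⨁ A_i`, `Y ~ ⨁ A'_j`, Galois closures meeting in a totally real field ⟹
`HodgeClassesProductSpan X Y`. [cite: MoonenZarhin1999LowDim, §3 (3.1)] [cite: vanGeemen1994HodgeAV, §3.6 (p. 236)] -/
theorem hodgeClassesProductSpan_of_isIsogenous_biproduct_of_conj_apply_eq [NeZero n] [NeZero m]
    (hA : ∀ i, IsCMTypeRealisation (Φ i) (A i) (ι i) (θ i))
    (hA' : ∀ j, IsCMTypeRealisation (Φ' j) (A' j) (ι' j) (θ' j))
    (hreal : ∀ x : ℂ, x ∈ (⨆ i, IntermediateField.normalClosure ℚ (K i) ℂ) →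
      x ∈ (⨆ j, IntermediateField.normalClosure ℚ (K' j) ℂ) → starRingEnd ℂ x = x)
    {X Y : AbelianVariety ℂ} (hXi : AbelianVariety.IsIsogenous X (⨁ A))
    (hYi : AbelianVariety.IsIsogenous Y (⨁ A')) : HodgeClassesProductSpan X Y :=
  (hodgeClassesProductSpan_biproduct_of_conj_apply_eq hA hA' hreal).of_isIsogenous hXi hYi

/-- **The Hodge conjecture is multiplicative across CM products whose Galois closures meet in a totally real field**:
for `X ~ ⨁ A_i`, `Y ~ ⨁ A'_j` (realisations of ARBITRARY CM types of CM fields `K_i`, `K'_j`) with complex conjugation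
fixing `(∏ K_i^{gal}) ∩ (∏ K'_j^{gal})` pointwise, `HC(X) ∧ HC(Y) ⟹ HC(X × Y)`.  The degenerate case is allowed on
both sides (HC of a factor may be, e.g., Markman's theorem for a Weil-type fourfold).
[cite: MoonenZarhin1999LowDim, §3 (3.1)] [cite: vanGeemen1994HodgeAV, §3.5–3.7 Lemma 3.7 (p. 236)] -/
theorem hodgeConjectureFor_prod_of_isIsogenous_biproduct_of_conj_apply_eq [NeZero n] [NeZero m]
    (hA : ∀ i, IsCMTypeRealisation (Φ i) (A i) (ι i) (θ i))
    (hA' : ∀ j, IsCMTypeRealisation (Φ' j) (A' j) (ι' j) (θ' j))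
    (hreal : ∀ x : ℂ, x ∈ (⨆ i, IntermediateField.normalClosure ℚ (K i) ℂ) →
      x ∈ (⨆ j, IntermediateField.normalClosure ℚ (K' j) ℂ) → starRingEnd ℂ x = x)
    {X Y : AbelianVariety ℂ} (hXi : AbelianVariety.IsIsogenous X (⨁ A))
    (hYi : AbelianVariety.IsIsogenous Y (⨁ A')) (hHX : HodgeConjectureFor X.dim X.X)
    (hHY : HodgeConjectureFor Y.dim Y.X) : HodgeConjectureFor (X.prod Y).dim (X.prod Y).X :=
  hodgeConjectureFor_prod_of_productSpan X Y
    (hodgeClassesProductSpan_of_isIsogenous_biproduct_of_conj_apply_eq hA hA' hreal hXi hYi) hHX hHY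

/-- **Odd-degree form**: `X ~ ⨁ A_i`, `Y ~ ⨁ A'_j` with `[(∏ K_i^{gal}) ∩ (∏ K'_j^{gal}) : ℚ]` ODD ⟹
`HC(X) ∧ HC(Y) ⟹ HC(X × Y)` (e.g. `ℚ(ζ₇)` against `ℚ(ζ₇)⁺(√−3)`: intersection the real cubic field).
[cite: MoonenZarhin1999LowDim, §3 (3.1)] [cite: Gordon1999HodgeAVSurvey, §3 Theorem (Imai, Murty), proof] -/
theorem hodgeConjectureFor_prod_of_isIsogenous_biproduct_of_odd_finrank_inf [NeZero n] [NeZero m]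
    (hA : ∀ i, IsCMTypeRealisation (Φ i) (A i) (ι i) (θ i))
    (hA' : ∀ j, IsCMTypeRealisation (Φ' j) (A' j) (ι' j) (θ' j))
    (hodd : Odd (Module.finrank ℚ ↥((⨆ i, IntermediateField.normalClosure ℚ (K i) ℂ) ⊓
      (⨆ j, IntermediateField.normalClosure ℚ (K' j) ℂ))))
    {X Y : AbelianVariety ℂ} (hXi : AbelianVariety.IsIsogenous X (⨁ A))
    (hYi : AbelianVariety.IsIsogenous Y (⨁ A')) (hHX : HodgeConjectureFor X.dim X.X)
    (hHY : HodgeConjectureFor Y.dim Y.X) : HodgeConjectureFor (X.prod Y).dim (X.prod Y).X :=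
  hodgeConjectureFor_prod_of_productSpan X Y
    ((hodgeClassesProductSpan_biproduct_of_typeRank_add hA hA'
      (typeRank_sum_add_one_eq_of_odd_finrank_inf Φ Φ' hodd)).of_isIsogenous hXi hYi) hHX hHY

end Main

end Literature.AlgebraicGeometry.Pohlmann1968

end
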